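import Literature.NumberTheory.LFunctions.SiegelAbelSummation
import Literature.NumberTheory.Sieve.LargeSieveCharacters
import HarnessLib

/-!
# The tail of `∑ χ(n)/n`: `∑_{n ≤ N} χ(n)/n = L(1, χ) + O(B/N)` for a character with partial
# sums bounded by `B` (Montgomery–Vaughan §11.2, Exercise 3(a))

Topic `Literature/NumberTheory/LFunctions`. Everything in this file is PROVED (theorems only).

For a non-principal Dirichlet character `χ` mod `q` whose partial sums `S(N) = ∑_{n ≤ N} χ(n)`
satisfy `|S(N)| ≤ B` for all `N`, Abel summation (the tree's
`Literature.NumberTheory.LFunctions.DirichletAbel.LFunction_eq_abelSum`: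
`L(1, χ) = ∑_{n ≥ 1} S(n)(1/n − 1/(n+1))`) gives
`|∑_{n ≤ N} χ(n)/n − L(1, χ)| ≤ 2B/(N + 1)` (`norm_sum_div_sub_LFunction_one_le`). With the
trivial `B = q` (MV (4.23)) and with the Pólya–Vinogradov bound `B = √q (1 + log q)` for
primitive `χ` (the tree's `Literature.NumberTheory.Sieve.LargeSieve.polyaVinogradov`) this is
Montgomery–Vaughan's Exercise 11.2.3(a): "`∑_{n ≤ y} χ(n)/n = L(1, χ) + O(q^{1/2} y^{−1} log q)`"
(`norm_sum_div_sub_LFunction_one_le_polyaVinogradov`), the first input of the evaluation of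
`∑_{n ≤ x} (1 ∗ χ)(n)/n` (loc. cit. (g)) used for exceptional characters by Tao–Teräväinen
(Prop. 3.5) and Matomäki–Merikoski (Lemma 4.1).

## References

* H. L. Montgomery, R. C. Vaughan, *Multiplicative Number Theory I*, CUP 2007, §11.2.1
  Exercise 3(a) (p. 285: "Show that `∑_{n ≤ y} χ(n)/n = L(1, χ) + O(q^{1/2} y^{−1} log q)`"),
  §4.3 (4.23), §1.3 Theorem 1.3. [cite: MontgomeryVaughan2007, §11.2.1 Exercise 3(a)]
-/

noncomputable section

open Complex Filter Topology Finset

namespace Literature.NumberTheory.LFunctions.DirichletAbel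

variable {q : ℕ} [NeZero q] (χ : DirichletCharacter ℂ q)

/-! ### The Abel terms at `s = 1` -/

omit [NeZero q] in
/-- At `s = 1` the Abel term is `S(n+1) (1/(n+1) − 1/(n+2))`. [folklore] -/
theorem term_one_eq (n : ℕ) :
    term χ n 1 = partialSum χ (n + 1) * ((1 / ((n : ℂ) + 1)) - 1 / ((n : ℂ) + 2)) := by
  unfold term
  rw [cpow_neg_one, cpow_neg_one]
  push_cast
  ring_nf

omit [NeZero q] in
/-- `‖term n 1‖ ≤ ‖S(n+1)‖ (1/(n+1) − 1/(n+2))`. [folklore] -/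
theorem norm_term_one_le (n : ℕ) :
    ‖term χ n 1‖ ≤ ‖partialSum χ (n + 1)‖ * (1 / ((n : ℝ) + 1) - 1 / ((n : ℝ) + 2)) := by
  rw [term_one_eq, norm_mul]
  refine mul_le_mul_of_nonneg_left (le_of_eq ?_) (norm_nonneg _)
  have h : (1 / ((n : ℂ) + 1)) - 1 / ((n : ℂ) + 2) = (((1 / ((n : ℝ) + 1) - 1 / ((n : ℝ) + 2)) : ℝ) : ℂ) := by
    push_cast; ring
  rw [h, Complex.norm_real, Real.norm_eq_abs, abs_of_nonneg]
  rw [sub_nonneg]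
  exact one_div_le_one_div_of_le (by positivity) (by linarith)

/-- Telescoping: `∑_{n < M} (1/(n+N+1) − 1/(n+N+2)) = 1/(N+1) − 1/(M+N+1)`. [folklore] -/
theorem sum_range_telescope (N M : ℕ) :
    ∑ n ∈ range M, (1 / ((n + N : ℕ) + 1 : ℝ) - 1 / ((n + N : ℕ) + 2 : ℝ)) =
      1 / ((N : ℝ) + 1) - 1 / ((M : ℝ) + N + 1) := by
  induction M with
  | zero => simp
  | succ M ih =>
    rw [sum_range_succ, ih]
    push_cast
    ring

/-- The telescoping series `∑_{n ≥ 0} (1/(n+N+1) − 1/(n+N+2))` has sum `1/(N+1)`. [folklore] -/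
theorem hasSum_telescope (N : ℕ) :
    HasSum (fun n : ℕ => 1 / ((n + N : ℕ) + 1 : ℝ) - 1 / ((n + N : ℕ) + 2 : ℝ)) (1 / ((N : ℝ) + 1)) := by
  have hnn : ∀ n : ℕ, 0 ≤ 1 / ((n + N : ℕ) + 1 : ℝ) - 1 / ((n + N : ℕ) + 2 : ℝ) := fun n => by
    rw [sub_nonneg]; exact one_div_le_one_div_of_le (by positivity) (by linarith)
  refine (hasSum_iff_tendsto_nat_of_nonneg hnn _).mpr ?_
  simp_rw [sum_range_telescope]
  have h1 : Tendsto (fun M : ℕ => (M : ℝ) + N + 1) atTop atTop := by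
    refine tendsto_atTop_add_const_right _ _ (tendsto_atTop_add_const_right _ _ ?_)
    exact tendsto_natCast_atTop_atTop
  have h2 : Tendsto (fun M : ℕ => 1 / ((M : ℝ) + N + 1)) atTop (𝓝 0) :=
    tendsto_const_nhds.div_atTop h1
  simpa using (tendsto_const_nhds (x := 1 / ((N : ℝ) + 1))).sub h2

/-- The tail of the Abel series at `s = 1` is `≤ B/(N+1)` when `|S(n)| ≤ B` for all `n`.
[cite: MontgomeryVaughan2007, §11.2.1 Exercise 3(a)] -/
theorem norm_tsum_term_one_add_le (hχ : χ ≠ 1) {B : ℝ} (hB : ∀ n, ‖partialSum χ n‖ ≤ B) (N : ℕ) :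
    ‖∑' n : ℕ, term χ (n + N) 1‖ ≤ B / ((N : ℝ) + 1) := by
  have hB0 : 0 ≤ B := (norm_nonneg _).trans (hB 0)
  have h1 : (0 : ℝ) < (1 : ℂ).re := by simp
  have hsum : Summable fun n : ℕ => term χ (n + N) 1 :=
    (summable_nat_add_iff N).mpr (summable_term χ hχ h1)
  rw [div_eq_mul_one_div]
  refine tsum_of_norm_bounded ((hasSum_telescope N).mul_left B) fun n => ?_
  refine (norm_term_one_le χ (n + N)).trans ?_
  have hnn : 0 ≤ 1 / ((n + N : ℕ) + 1 : ℝ) - 1 / ((n + N : ℕ) + 2 : ℝ) := by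
    rw [sub_nonneg]; exact one_div_le_one_div_of_le (by positivity) (by linarith)
  push_cast at hnn ⊢
  exact mul_le_mul_of_nonneg_right (hB _) hnn

/-! ### Exercise 11.2.3(a) -/

/-- **Montgomery–Vaughan, Exercise 11.2.3(a), with a general partial-sum bound**: if `χ ≠ χ₀`
and `|∑_{n ≤ M} χ(n)| ≤ B` for all `M`, then for every `N`,
`|∑_{n=1}^{N} χ(n)/n − L(1, χ)| ≤ 2B/(N + 1)`
(Abel summation: `∑_{n ≤ N} χ(n)/n = S(N)/(N+1) + ∑_{n ≤ N} S(n)(1/n − 1/(n+1))` and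
`L(1, χ) = ∑_{n ≥ 1} S(n)(1/n − 1/(n+1))`). [cite: MontgomeryVaughan2007, §11.2.1 Exercise 3(a)] -/
theorem norm_sum_div_sub_LFunction_one_le (hχ : χ ≠ 1) {B : ℝ} (hB : ∀ n, ‖partialSum χ n‖ ≤ B)
    (N : ℕ) :
    ‖(∑ n ∈ range N, χ ((n + 1 : ℕ) : ZMod q) / ((n : ℂ) + 1)) - χ.LFunction 1‖ ≤
      2 * B / ((N : ℝ) + 1) := by
  have h1 : (0 : ℝ) < (1 : ℂ).re := by simp
  have hL : χ.LFunction 1 = ∑' n : ℕ, term χ n 1 := LFunction_eq_abelSum χ hχ h1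
  have hsplit : ∑' n : ℕ, term χ n 1 = (∑ n ∈ range N, term χ n 1) + ∑' n : ℕ, term χ (n + N) 1 :=
    ((summable_term χ hχ h1).sum_add_tsum_nat_add N).symm
  have habel := sum_apply_mul_cpow_eq χ 1 N
  have hsum_eq : ∑ n ∈ range N, χ ((n + 1 : ℕ) : ZMod q) / ((n : ℂ) + 1) =
      ∑ n ∈ range N, χ ((n + 1 : ℕ) : ZMod q) * ((n + 1 : ℕ) : ℂ) ^ (-(1 : ℂ)) := by
    refine sum_congr rfl fun n _ => ?_
    rw [cpow_neg_one]; push_cast; ring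
  rw [hsum_eq, habel, hL, hsplit, cpow_neg_one]
  have hcalc : partialSum χ N * ((N + 1 : ℕ) : ℂ)⁻¹ + ∑ n ∈ range N, term χ n 1 -
      ((∑ n ∈ range N, term χ n 1) + ∑' n : ℕ, term χ (n + N) 1) =
      partialSum χ N * ((N + 1 : ℕ) : ℂ)⁻¹ - ∑' n : ℕ, term χ (n + N) 1 := by ring
  rw [hcalc]
  refine (norm_sub_le _ _).trans ?_
  have hfirst : ‖partialSum χ N * ((N + 1 : ℕ) : ℂ)⁻¹‖ ≤ B / ((N : ℝ) + 1) := by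
    rw [norm_mul, norm_inv, Complex.norm_natCast, div_eq_mul_inv]
    push_cast
    exact mul_le_mul_of_nonneg_right (hB N) (by positivity)
  have hsecond := norm_tsum_term_one_add_le χ hχ hB N
  have : 2 * B / ((N : ℝ) + 1) = B / ((N : ℝ) + 1) + B / ((N : ℝ) + 1) := by ring
  rw [this]
  exact add_le_add hfirst hsecond

/-- Exercise 11.2.3(a) with the trivial bound `|S(N)| ≤ q` (MV (4.23)):
`|∑_{n=1}^{N} χ(n)/n − L(1, χ)| ≤ 2q/(N + 1)` for every `χ ≠ χ₀` mod `q`.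
[cite: MontgomeryVaughan2007, §11.2.1 Exercise 3(a)] -/
theorem norm_sum_div_sub_LFunction_one_le_level (hχ : χ ≠ 1) (N : ℕ) :
    ‖(∑ n ∈ range N, χ ((n + 1 : ℕ) : ZMod q) / ((n : ℂ) + 1)) - χ.LFunction 1‖ ≤
      2 * q / ((N : ℝ) + 1) :=
  norm_sum_div_sub_LFunction_one_le χ hχ (fun n => norm_partialSum_le χ hχ n) N

omit [NeZero q] in
/-- The partial sums of the tree's `DirichletAbel.partialSum` are the interval sums
`∑_{n ∈ (0, N]} χ(n)` of `polyaVinogradov`. [folklore] -/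
theorem partialSum_eq_sum_Ioc (N : ℕ) :
    partialSum χ N = ∑ n ∈ Ioc 0 (0 + N), χ (n : ZMod q) := by
  unfold partialSum
  rw [zero_add, ← Finset.Ico_add_one_add_one_eq_Ioc, Finset.sum_Ico_eq_sum_range,
    show N + 1 - (0 + 1) = N by omega]
  refine sum_congr rfl fun n _ => ?_
  rw [show 0 + 1 + n = n + 1 by omega]

omit [NeZero q] in
/-- **Pólya–Vinogradov bound for the partial sums**: `|S(N)| ≤ √q (1 + log q)` for `χ`
primitive mod `q ≥ 2` (the tree's `polyaVinogradov`). [cite: MontgomeryVaughan2007, §9.4] -/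
theorem norm_partialSum_le_polyaVinogradov (hq : 2 ≤ q) (hχ : χ.IsPrimitive) (N : ℕ) :
    ‖partialSum χ N‖ ≤ Real.sqrt q * (1 + Real.log q) := by
  rw [partialSum_eq_sum_Ioc]
  exact Literature.NumberTheory.Sieve.LargeSieve.polyaVinogradov hq hχ 0 N

/-- **Montgomery–Vaughan, Exercise 11.2.3(a)**: for `χ` primitive mod `q ≥ 2` and every `N`,
`|∑_{n=1}^{N} χ(n)/n − L(1, χ)| ≤ 2√q (1 + log q)/(N + 1)` ("`∑_{n ≤ y} χ(n)/n = L(1, χ) +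
O(q^{1/2} y^{−1} log q)`"). [cite: MontgomeryVaughan2007, §11.2.1 Exercise 3(a)] -/
theorem norm_sum_div_sub_LFunction_one_le_polyaVinogradov (hq : 2 ≤ q) (hχ : χ.IsPrimitive)
    (N : ℕ) :
    ‖(∑ n ∈ range N, χ ((n + 1 : ℕ) : ZMod q) / ((n : ℂ) + 1)) - χ.LFunction 1‖ ≤
      2 * (Real.sqrt q * (1 + Real.log q)) / ((N : ℝ) + 1) := by
  have hχ1 : χ ≠ 1 := by
    rintro rfl
    rw [DirichletCharacter.isPrimitive_def, DirichletCharacter.conductor_one] at hχ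
    omega
  exact norm_sum_div_sub_LFunction_one_le χ hχ1 (norm_partialSum_le_polyaVinogradov χ hq hχ) N

end Literature.NumberTheory.LFunctions.DirichletAbel
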